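import Summits.CriticalPhenomena.CardyFormulaZ2.Theorems.CardyIKTransportIKLinearTransportStubCrudeCardySiteTriPart2
import Literature.Probability.Percolation.CardyFormulaConformalInvariance
import Literature.Probability.Percolation.TriApproxDomainDualPathProofs
import Literature.Probability.Percolation.TriLemma13

/-!
# Crude Cardy for site percolation on `𝕋` with general slack — Part 3: the limit and the crude upper bound

Support file (`--supports stmt-CriticalPhenomena-5076`) of the line `pinned-diagram-exchange` of the crux
`CardyIKTransport.IKLinearTransport` (stmt-CriticalPhenomena-5076), stub `stub_CrudeCardySiteTri`,
continuing Parts 1–2.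

* `tendsto_openCrossingProb_of_isDiscreteApprox` — for every discrete approximation `G_δ` of a conformal
  rectangle with an anticlockwise Carleson datum, `P_δ(G_δ) → |d - c|/|a - c|` (Bollobás–Riordan, Ch. 7,
  pp. 202–203, assembled from the tree's (40), separating data, interpolants and Arzelà–Ascoli passage).
* `crude_upper` — for every conformal rectangle, slack `s ≥ 0` and uniformizing datum `(φ, x)`:
  eventually `P(crude_s(R, δ)) ≤ F(η(x)) + ε` (clockwise data through the conjugate rectangle; the crude
  event is reflection-symmetric, `crude_conjSet_eq_preimage`).
* `triCrossing_subset_crude` — G02's crossing event implies the crude event (slack `≥ 1`), the lower half.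
* `infDist_image_le_of_dist_le`, `infDist_le_mul_infDist_image` — distances to sets under coarse
  (co-)Lipschitz maps (for the transport by the shear in Part 4).

References: B. Bollobás, O. Riordan, *Percolation*, CUP (2006), Ch. 7, Thm. 2 p. 165, (40) p. 201,
pp. 196–203; S. Smirnov, C. R. Acad. Sci. Paris 333 (2001), Thm. 1.
-/

noncomputable section

namespace Summit.CriticalPhenomena.CardyFormulaZ2.Theorems.IKLinearTransport.PinnedDiagramExchange

open scoped BigOperators Topology Classical MeasureTheory
open Filter Set Function MeasureTheory Metric
open Literature.Probability.Percolation Literature.Probability.LatticeModels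
open Literature.Probability.RandomPlanarGeometry

/-! ## §5 The open crossing probabilities of a discrete approximation tend to Carleson's ratio -/

/-- **`P(G_δ has an open crossing from arc 0 to arc 2) → h¹(d) = |d - c|/|a - c|`** for every discrete
approximation `G_δ` of a conformal rectangle with an anticlockwise Carleson datum (Bollobás–Riordan 2006,
Ch. 7, pp. 202–203: "`P_δ(G_δ) = f²_δ(z_δ) + o(1) = h²(φ(P₄)) + o(1)`", the same for `G_δ⁺`): (40)
(`tri_openCrossingProb_approx_sepProb_holds`), the separating data of the approximation
(`isSeparatingData_of_discreteApprox'`), their interpolants (`IsSeparatingData.isSmirnovFamily`,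
`dataFamily_approx`) and the Arzelà–Ascoli passage to the limit (`IsSmirnovFamily.tendsto_apply_one`).
[cite: BollobasRiordan2006, Ch. 7 proof of Thm. 2 pp. 202–203, (40) p. 201] -/
theorem tendsto_openCrossingProb_of_isDiscreteApprox (R : ConformalRectangle) {a b c d : ℂ}
    (ψ : ConformalEquiv R.carrier (openTriangle a b c)) (habc : IsEquilateral a b c) (hd : d ∈ openSegment ℝ c a)
    (hψ : IsCarlesonMap R a b c d ψ) (hacw : triangleTurn a b c = triOmega)
    {G : ℝ → TriMarkedDomain 4} (hG : IsDiscreteApprox R G) :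
    Tendsto (fun δ => (G δ).openCrossingProb 0 2) (𝓝[>] 0) (𝓝 (carlesonRatio a c d)) := by
  have hD := isSeparatingData_of_discreteApprox' tri_discreteCauchy_holds tri_sepProb_boundary_tendsto_holds hG
  rw [← hacw] at hD
  obtain ⟨ε, hε, hdense⟩ := hD.dense
  obtain ⟨zs, hzs, hzt, hdiff⟩ := tri_openCrossingProb_approx_sepProb_holds R G hG
  obtain ⟨δ₀, hδ₀, hgood⟩ := exists_forall_Ioo_of_eventually hzs
  have hg := hD.isSmirnovFamily hε hdense δ₀
  have hlim := hg.tendsto_apply_one triangleIntegral_eq_zero_of_forall_lattice_holds smirnov_claim24_holds hδ₀ habc hd hψ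
    (z := fun δ => (δ : ℂ) * hexCenter (zs δ)) (fun δ hδ => (hgood δ hδ).2) hzt
  set S : ℝ → Finset ℂ := fun δ => ((G δ).faces).image fun w => (δ : ℂ) * hexCenter w with hS
  set f : ℝ → Fin 3 → ℂ → ℝ := fun δ i => (G δ).dropLast.sepProbFun δ i with hf
  -- `g - f → 0` at the points `z_δ ∈ S_δ`
  have happrox : Tendsto (fun δ => dataFamily S f ε δ 1 ((δ : ℂ) * hexCenter (zs δ)) - f δ 1 ((δ : ℂ) * hexCenter (zs δ)))
      (𝓝[>] 0) (𝓝 0) := by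
    rw [Metric.tendsto_nhds]
    intro β hβ
    filter_upwards [dataFamily_approx hD hε (half_pos hβ), hzs] with δ happ hz
    have h := happ 1 ((δ : ℂ) * hexCenter (zs δ)) (Finset.mem_image_of_mem _ hz.1)
    rw [Real.dist_0_eq_abs, abs_lt]
    constructor <;> linarith [h.1, h.2]
  -- `f(z_δ) = P(E¹(z_δ))`, so `P(G_δ) = (P(G_δ) - f(z_δ)) - (g - f)(z_δ) + g(z_δ)`
  have hpos : ∀ᶠ δ in 𝓝[>] (0 : ℝ), (0 : ℝ) < δ := eventually_mem_nhdsWithin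
  have key : ∀ᶠ δ in 𝓝[>] (0 : ℝ), (G δ).openCrossingProb 0 2 =
      ((G δ).openCrossingProb 0 2 - (G δ).dropLast.sepProb 1 (zs δ)) -
        (dataFamily S f ε δ 1 ((δ : ℂ) * hexCenter (zs δ)) - f δ 1 ((δ : ℂ) * hexCenter (zs δ))) +
        dataFamily S f ε δ 1 ((δ : ℂ) * hexCenter (zs δ)) := by
    filter_upwards [hpos] with δ hδ
    have : f δ 1 ((δ : ℂ) * hexCenter (zs δ)) = (G δ).dropLast.sepProb 1 (zs δ) :=
      (G δ).dropLast.sepProbFun_apply hδ.ne' 1 (zs δ)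
    rw [this]; ring
  have h := (hdiff.sub happrox).add hlim
  simp only [sub_zero, zero_add] at h
  exact h.congr' (key.mono fun δ hδ => hδ.symm)

/-! ## §6 Reflection symmetry and the crude upper bound for every conformal rectangle -/

/-- **The crude event of the conjugate data is the relabelled crude event** (lattice reflection
`triConj` of `𝕋`, under which `triEmbed` is conjugated). [folklore] -/
theorem crude_conjSet_eq_preimage (Ω A B : Set ℂ) (s δ : ℝ) :
    {ω : SiteConfig (Site 2) | ∃ u v : Site 2, infDist (triMeshPoint δ u) (conjSet A) ≤ s * δ ∧
        infDist (triMeshPoint δ v) (conjSet B) ≤ s * δ ∧ ω ∈ siteConnIn triGraph (triMeshVertices (conjSet Ω) δ) u v} =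
      SiteConfig.relabel triConj ⁻¹' {ω | ∃ u v : Site 2, infDist (triMeshPoint δ u) A ≤ s * δ ∧
        infDist (triMeshPoint δ v) B ≤ s * δ ∧ ω ∈ siteConnIn triGraph (triMeshVertices Ω δ) u v} := by
  ext ω
  simp only [mem_setOf_eq, mem_preimage]
  have hV : triMeshVertices Ω δ = triConjIso '' (triMeshVertices (conjSet Ω) δ) := by
    ext z
    simp only [mem_image]
    constructor
    · intro hz
      refine ⟨triConjFun z, ?_, triConjFun_triConjFun z⟩
      rw [mem_triMeshVertices_conjSet_iff, triConjFun_triConjFun]; exact hz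
    · rintro ⟨w, hw, rfl⟩
      exact (mem_triMeshVertices_conjSet_iff Ω δ w).1 hw
  have key : ∀ x y : Site 2, ω ∈ siteConnIn triGraph (triMeshVertices (conjSet Ω) δ) x y ↔
      SiteConfig.relabel triConj ω ∈ siteConnIn triGraph (triMeshVertices Ω δ) (triConjFun x) (triConjFun y) := by
    intro x y
    rw [← relabel_mem_siteConnIn_iff triConjIso ω (triMeshVertices (conjSet Ω) δ) x y, ← hV]
    rfl
  have hdist : ∀ (x : Site 2) (C : Set ℂ),
      infDist (triMeshPoint δ x) (conjSet C) = infDist (triMeshPoint δ (triConjFun x)) C := by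
    intro x C; rw [infDist_conjSet, triMeshPoint_triConjFun]
  constructor
  · rintro ⟨x, y, hx, hy, hω⟩
    exact ⟨triConjFun x, triConjFun y, by rwa [← hdist], by rwa [← hdist], (key x y).1 hω⟩
  · rintro ⟨x, y, hx, hy, hω⟩
    refine ⟨triConjFun x, triConjFun y, ?_, ?_, ?_⟩
    · rw [hdist, triConjFun_triConjFun]; exact hx
    · rw [hdist, triConjFun_triConjFun]; exact hy
    · rw [key, triConjFun_triConjFun, triConjFun_triConjFun]; exact hω

/-- **Crude upper bound** (all orientations): for every conformal rectangle `R`, slack `s ≥ 0`,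
uniformizing datum `(φ, x)` and `ε > 0`, eventually as `δ → 0⁺` the crude crossing probability is at most
`F(η(x)) + ε`. Anticlockwise Carleson data: `exists_discreteApprox_crude`,
`tendsto_openCrossingProb_of_isDiscreteApprox` and the Cardy–Carleson identity; clockwise data: pass to
the conjugate rectangle (the crude event is reflection-symmetric, `crude_conjSet_eq_preimage`).
[cite: BollobasRiordan2006, Ch. 7 Thm. 2 p. 165, proof pp. 202–203] -/
theorem crude_upper : ∀ (R : ConformalRectangle) {s : ℝ}, 0 ≤ s →
    ∀ (φ : ConformalEquiv UpperHalfPlane.upperHalfPlaneSet R.carrier) (x : Fin 4 → ℝ), R.IsUniformizing φ x →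
    ∀ {ε : ℝ}, 0 < ε → ∀ᶠ δ in 𝓝[>] (0 : ℝ), (triSitePercolation half).real {ω | ∃ u v : Site 2,
        Metric.infDist (triMeshPoint δ u) (R.arc 0) ≤ s * δ ∧ Metric.infDist (triMeshPoint δ v) (R.arc 2) ≤ s * δ ∧
        ω ∈ siteConnIn triGraph (triMeshVertices R.carrier δ) u v} ≤
      Literature.Probability.RandomPlanarGeometry.cardyFunction (crossRatio x) + ε := by
  intro R s hs φ x hφx ε hε
  obtain ⟨a, b, c, d, ψ, habc, hd, hψ⟩ := exists_isCarlesonMap_holds R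
  rw [cardyFunction_crossRatio_eq_carlesonRatio_holds R a b c d ψ φ x habc hd hψ hφx]
  have main : ∀ (R' : ConformalRectangle) (a' b' c' d' : ℂ) (ψ' : ConformalEquiv R'.carrier (openTriangle a' b' c')),
      IsEquilateral a' b' c' → d' ∈ openSegment ℝ c' a' → IsCarlesonMap R' a' b' c' d' ψ' →
      triangleTurn a' b' c' = triOmega →
      ∀ᶠ δ in 𝓝[>] (0 : ℝ), (triSitePercolation half).real {ω | ∃ u v : Site 2,
        infDist (triMeshPoint δ u) (R'.arc 0) ≤ s * δ ∧ infDist (triMeshPoint δ v) (R'.arc 2) ≤ s * δ ∧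
        ω ∈ siteConnIn triGraph (triMeshVertices R'.carrier δ) u v} ≤ carlesonRatio a' c' d' + ε := by
    intro R' a' b' c' d' ψ' habc' hd' hψ' hacw'
    have hR1 : ∀ z ∈ R'.carrier, R'.index z = 1 := fun z hz => index_eq_one_of_isCarlesonMap R' ψ' habc' hψ' hacw' hz
    obtain ⟨Gp, hGp, e, he, hsand⟩ := exists_discreteApprox_crude R' hR1 hs
    have hlim := tendsto_openCrossingProb_of_isDiscreteApprox R' ψ' habc' hd' hψ' hacw' hGp
    have h2 : Tendsto (fun δ => (Gp δ).openCrossingProb 0 2 + e δ) (𝓝[>] 0) (𝓝 (carlesonRatio a' c' d')) := by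
      simpa using hlim.add he
    filter_upwards [hsand, h2 (Iio_mem_nhds (show carlesonRatio a' c' d' < carlesonRatio a' c' d' + ε by linarith))]
      with δ h1 h3
    exact h1.trans (le_of_lt h3)
  rcases triangleTurn_eq_or_of_isEquilateral habc with hacw | hcw
  · exact main R a b c d ψ habc hd hψ hacw
  · -- the clockwise case: pass to the conjugate rectangle
    set R' : ConformalRectangle := R.conjugate with hR'
    set ψ' : ConformalEquiv R'.carrier (openTriangle (starRingEnd ℂ a) (starRingEnd ℂ b) (starRingEnd ℂ c)) :=
      (ψ.conjugate R.isOpen (isOpen_openTriangle a b c)).trans (ConformalEquiv.ofEq (conjSet_openTriangle a b c)) with hψ'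
    have habc' := habc.conj
    have hd' := mem_openSegment_conj hd
    have hbv : ∀ (i : Fin 4) (w : ℂ), ψ.HasBoundaryValue (R.pt i) w →
        ψ'.HasBoundaryValue (R'.pt i) (starRingEnd ℂ w) := fun i w hw =>
      ConformalEquiv.HasBoundaryValue.conjugate R.isOpen (isOpen_openTriangle a b c) hw
    have hψ'C : IsCarlesonMap R' (starRingEnd ℂ a) (starRingEnd ℂ b) (starRingEnd ℂ c) (starRingEnd ℂ d) ψ' :=
      ⟨hbv 0 a hψ.1, hbv 1 b hψ.2.1, hbv 2 c hψ.2.2.1, hbv 3 d hψ.2.2.2⟩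
    have hacw' : triangleTurn (starRingEnd ℂ a) (starRingEnd ℂ b) (starRingEnd ℂ c) = triOmega := by
      rw [triangleTurn_conj, hcw, Complex.conj_conj]; rfl
    have h := main R' _ _ _ _ ψ' habc' hd' hψ'C hacw'
    have hcR : carlesonRatio (starRingEnd ℂ a) (starRingEnd ℂ c) (starRingEnd ℂ d) = carlesonRatio a c d := by
      simp only [carlesonRatio, ← map_sub, Complex.norm_conj]
    rw [hcR] at h
    refine h.mono fun δ hδ => ?_
    rwa [hR', MarkedDomain.conjugate_carrier, MarkedDomain.conjugate_arc, MarkedDomain.conjugate_arc,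
      crude_conjSet_eq_preimage, triSitePercolation, sitePercolation_real_preimage_relabel] at hδ

/-! ## §7 The lower half: G02's crossing event is a crude crossing -/

/-- **G02's crossing event implies the crude event** (slack `s ≥ 1`): a crossing of `Ω_δ` between the
discrete arcs is an open `𝕋`-path with sites in `Ω` whose end sites are within `δ` of the two arcs
(`infDist_le_of_mem_triDiscreteArc`). [cite: Smirnov2001, §2] -/
theorem triCrossing_subset_crude (R : ConformalRectangle) {s δ : ℝ} (hs : 1 ≤ s) (hδ : 0 < δ) :
    triCrossing R.carrier δ (R.arc 0) (R.arc 2) ⊆ {ω | ∃ u v : Site 2, infDist (triMeshPoint δ u) (R.arc 0) ≤ s * δ ∧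
      infDist (triMeshPoint δ v) (R.arc 2) ≤ s * δ ∧ ω ∈ siteConnIn triGraph (triMeshVertices R.carrier δ) u v} := by
  rintro ω ⟨x, hx, y, hy, hconn⟩
  have hδabs : |δ| = δ := abs_of_pos hδ
  have hx0 : infDist (triMeshPoint δ x) (R.arc 0) ≤ δ := by
    have := infDist_le_of_mem_triDiscreteArc R.isOpen hx; rwa [hδabs] at this
  have hy2 : infDist (triMeshPoint δ y) (R.arc 2) ≤ δ := by
    have := infDist_le_of_mem_triDiscreteArc R.isOpen hy; rwa [hδabs] at this
  refine ⟨x, y, hx0.trans (by nlinarith), hy2.trans (by nlinarith), ?_⟩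
  have hP := mem_siteConnIn_iff_pathIn.1 hconn
  refine mem_siteConnIn_iff_pathIn.2 ((hP.mono_graph ?_).mono (inter_subset_inter_left _ (triMeshDomain_subset_triMeshVertices _ _)))
  exact (triDiscreteDomainGraph_le_triMeshGraph _ _).trans (triMeshGraph_le_triGraph _ _)

/-! ## §8 Distances to sets under coarse bi-Lipschitz maps -/

/-- Coarse Lipschitz maps shrink distances to sets by at most their constant. [folklore] -/
theorem infDist_image_le_of_dist_le {f : ℂ → ℂ} {C : ℝ} (hC : 0 < C) (h : ∀ z w, dist (f z) (f w) ≤ C * dist z w)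
    (p : ℂ) (A : Set ℂ) : infDist (f p) (f '' A) ≤ C * infDist p A := by
  rcases A.eq_empty_or_nonempty with rfl | hA
  · simp
  have key : infDist (f p) (f '' A) / C ≤ infDist p A := by
    rw [le_infDist hA]
    intro a ha
    rw [div_le_iff₀ hC]
    exact (infDist_le_dist_of_mem (mem_image_of_mem f ha)).trans (by rw [mul_comm]; exact h p a)
  rwa [div_le_iff₀ hC, mul_comm] at key

/-- Coarse co-Lipschitz maps expand distances to sets by at most their constant. [folklore] -/
theorem infDist_le_mul_infDist_image {f : ℂ → ℂ} {C : ℝ} (hC : 0 < C) (h : ∀ z w, dist z w ≤ C * dist (f z) (f w))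
    (p : ℂ) (A : Set ℂ) : infDist p A ≤ C * infDist (f p) (f '' A) := by
  rcases A.eq_empty_or_nonempty with rfl | hA
  · simp
  have key : infDist p A / C ≤ infDist (f p) (f '' A) := by
    rw [le_infDist (hA.image f)]
    rintro _ ⟨a, ha, rfl⟩
    rw [div_le_iff₀ hC]
    exact (infDist_le_dist_of_mem ha).trans (by rw [mul_comm]; exact h p a)
  rwa [div_le_iff₀ hC, mul_comm] at key


end Summit.CriticalPhenomena.CardyFormulaZ2.Theorems.IKLinearTransport.PinnedDiagramExchange
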